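import Mathlib.Analysis.Complex.CauchyIntegral
import Mathlib.Analysis.Analytic.Uniqueness
import Mathlib.Analysis.Convex.Topology
import Literature.Analysis.Complex.VitaliConvergence

/-!
# Amplitude transfer — the Vitali step and the endpoint step (pure analysis)

Two analysis lemmas of the Vitali amplitude transfer (route `VitaliAmplitudeTransfer`, item
`AmplitudeTransfer`), with no particle system in sight:

* `tendsto_of_vitali` — a sequence of real functions `m N` on `[0,1]`, each the restriction of a
  holomorphic function bounded by one constant `M` on the `r`-neighbourhood of `[0,1] ⊂ ℂ`, which
  converges pointwise on a small interval `(0, δ₁)` to a function `e` real-analytic on `[0,1]`,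
  converges to `e` on all of `[0,1]` (Vitali–Porter on the convex neighbourhood, then the identity
  theorem on `[0,1]`);
* `tendsto_endpoint` — if `m N δ → e δ` for every `δ ∈ [0,1)`, the `m N` are equi-Lipschitz at
  `1` and `e` is continuous at `1` from inside `[0,1]`, then `m N 1 → e 1`.
-/

open Filter Set Topology Metric

namespace Summit.AtomisticToContinuum.HydrodynamicLimit.Theorems.AmplitudeTransfer

/-- The `r`-neighbourhood of the real segment `[0,1]` in `ℂ` is convex. -/
theorem convex_thickening_segment (r : ℝ) :
    Convex ℝ (thickening r (Complex.ofReal '' Icc (0 : ℝ) 1)) := by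
  refine Convex.thickening ?_ r
  have : Complex.ofReal '' Icc (0 : ℝ) 1 = Complex.ofRealCLM '' Icc (0 : ℝ) 1 := rfl
  rw [this]
  exact (convex_Icc 0 1).linear_image Complex.ofRealCLM.toLinearMap

/-- Real points of `[0,1]` lie in the `r`-neighbourhood of `[0,1] ⊂ ℂ` (`r > 0`). -/
theorem ofReal_mem_thickening_segment {r : ℝ} (hr : 0 < r) {δ : ℝ} (hδ : δ ∈ Icc (0 : ℝ) 1) :
    (δ : ℂ) ∈ thickening r (Complex.ofReal '' Icc (0 : ℝ) 1) :=
  mem_thickening_iff.2 ⟨δ, mem_image_of_mem _ hδ, by simpa using hr⟩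

/-- **The Vitali step.** Let `m N : ℝ → ℝ` be, on `[0,1]`, restrictions of holomorphic functions
`g_N` bounded by one constant on the `r`-neighbourhood of `[0,1] ⊂ ℂ`, converging pointwise on
`(0, δ₁)` to `e`, with `e` real-analytic on `[0,1]`. Then `m N δ → e δ` for every `δ ∈ [0,1]`. -/
theorem tendsto_of_vitali {m : ℕ → ℝ → ℝ} {e : ℝ → ℝ} {r : ℝ} (hr : 0 < r) {M : ℝ}
    (hg : ∀ N, ∃ g : ℂ → ℂ, DifferentiableOn ℂ g (thickening r (Complex.ofReal '' Icc (0 : ℝ) 1)) ∧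
      (∀ ζ ∈ thickening r (Complex.ofReal '' Icc (0 : ℝ) 1), ‖g ζ‖ ≤ M) ∧
      ∀ δ ∈ Icc (0 : ℝ) 1, g (δ : ℂ) = ((m N δ : ℝ) : ℂ))
    {δ₁ : ℝ} (hδ₁ : 0 < δ₁) (hδ₁1 : δ₁ ≤ 1)
    (hconv : ∀ δ ∈ Ioo (0 : ℝ) δ₁, Tendsto (fun N => m N δ) atTop (𝓝 (e δ)))
    (he : AnalyticOnNhd ℝ e (Icc (0 : ℝ) 1)) :
    ∀ δ ∈ Icc (0 : ℝ) 1, Tendsto (fun N => m N δ) atTop (𝓝 (e δ)) := by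
  set U : Set ℂ := thickening r (Complex.ofReal '' Icc (0 : ℝ) 1) with hU
  choose g hgd hgb hgm using hg
  have hUo : IsOpen U := isOpen_thickening
  have hUc : IsPreconnected U := (convex_thickening_segment r).isPreconnected
  -- the base point `z₀ = δ₁/2`
  have hz₀I : δ₁ / 2 ∈ Icc (0 : ℝ) 1 := ⟨by linarith, by linarith⟩
  have hz₀ : ((δ₁ / 2 : ℝ) : ℂ) ∈ U := ofReal_mem_thickening_segment hr hz₀I
  -- pointwise convergence frequently near `z₀` (at the real points of `(0, δ₁)`)
  have hS : ∃ᶠ z in 𝓝[≠] (((δ₁ / 2 : ℝ) : ℂ)), ∃ c : ℂ, Tendsto (fun n => g n z) atTop (𝓝 c) := by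
    rw [Filter.Frequently]
    intro hev
    rw [eventually_nhdsWithin_iff, Metric.eventually_nhds_iff] at hev
    obtain ⟨ε, hε, hεp⟩ := hev
    set η : ℝ := min ε δ₁ / 4 with hη
    have hη0 : 0 < η := by positivity
    have hηε : η < ε := by
      have : min ε δ₁ ≤ ε := min_le_left _ _
      rw [hη]; linarith
    have hηδ : δ₁ / 2 + η < δ₁ := by
      have : min ε δ₁ ≤ δ₁ := min_le_right _ _
      rw [hη]; linarith
    have hx : δ₁ / 2 + η ∈ Ioo (0 : ℝ) δ₁ := ⟨by linarith, hηδ⟩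
    have hxI : δ₁ / 2 + η ∈ Icc (0 : ℝ) 1 := ⟨by linarith, by linarith⟩
    have hdist : dist (((δ₁ / 2 + η : ℝ) : ℂ)) (((δ₁ / 2 : ℝ) : ℂ)) < ε := by
      rw [Complex.dist_eq, ← Complex.ofReal_sub, Complex.norm_real, Real.norm_eq_abs]
      rw [show δ₁ / 2 + η - δ₁ / 2 = η by ring, abs_of_pos hη0]
      exact hηε
    have hne : ((δ₁ / 2 + η : ℝ) : ℂ) ∈ ({((δ₁ / 2 : ℝ) : ℂ)}ᶜ : Set ℂ) := by
      rw [mem_compl_singleton_iff, Ne, Complex.ofReal_inj]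
      linarith
    refine hεp hdist hne ⟨((e (δ₁ / 2 + η) : ℝ) : ℂ), ?_⟩
    have h1 := (Complex.continuous_ofReal.tendsto _).comp (hconv _ hx)
    refine h1.congr fun n => ?_
    simp only [Function.comp_apply]
    exact (hgm n _ hxI).symm
  -- Vitali–Porter: a holomorphic locally uniform limit `G` on `U`
  obtain ⟨G, hGd, hGc⟩ :=
    Literature.Analysis.Complex.exists_tendstoLocallyUniformlyOn_of_frequently_tendsto hUo hUc hgd
      (fun a _ => ⟨M, 1, one_pos, fun n z hz => hgb n z hz.2⟩) hz₀ hS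
  -- pointwise convergence on the real segment
  have hpt : ∀ δ ∈ Icc (0 : ℝ) 1, Tendsto (fun N => ((m N δ : ℝ) : ℂ)) atTop (𝓝 (G δ)) := by
    intro δ hδ
    have h := hGc.tendsto_at (ofReal_mem_thickening_segment hr hδ)
    exact h.congr fun N => hgm N δ hδ
  -- identification of `G` with `e` on `(0, δ₁)`, then on `[0,1]` by the identity theorem
  have hGe : ∀ δ ∈ Ioo (0 : ℝ) δ₁, G δ = ((e δ : ℝ) : ℂ) := by
    intro δ hδ
    have hδI : δ ∈ Icc (0 : ℝ) 1 := ⟨hδ.1.le, by linarith [hδ.2]⟩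
    exact tendsto_nhds_unique (hpt δ hδI) ((Complex.continuous_ofReal.tendsto _).comp (hconv δ hδ))
  have hf₁ : AnalyticOnNhd ℝ (fun x : ℝ => G (x : ℂ)) (Icc (0 : ℝ) 1) := by
    intro x hx
    have hGa : AnalyticAt ℂ G (x : ℂ) :=
      (hGd.analyticOnNhd hUo) _ (ofReal_mem_thickening_segment hr hx)
    exact (hGa.restrictScalars (𝕜 := ℝ)).comp (Complex.ofRealCLM.analyticAt x)
  have hf₂ : AnalyticOnNhd ℝ (fun x : ℝ => ((e x : ℝ) : ℂ)) (Icc (0 : ℝ) 1) := fun x hx =>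
    (Complex.ofRealCLM.analyticAt (e x)).comp (he x hx)
  have hEq : EqOn (fun x : ℝ => G (x : ℂ)) (fun x : ℝ => ((e x : ℝ) : ℂ)) (Icc (0 : ℝ) 1) := by
    refine hf₁.eqOn_of_preconnected_of_eventuallyEq hf₂ isPreconnected_Icc hz₀I ?_
    have hmem : Ioo (0 : ℝ) δ₁ ∈ 𝓝 (δ₁ / 2) := Ioo_mem_nhds (by linarith) (by linarith)
    filter_upwards [hmem] with x hx
    exact hGe x hx
  intro δ hδ
  have h := hpt δ hδ
  rw [show G δ = ((e δ : ℝ) : ℂ) from hEq hδ] at h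
  have h2 : Tendsto (fun N => (((m N δ : ℝ) : ℂ)).re) atTop (𝓝 (((e δ : ℝ) : ℂ).re)) :=
    (Complex.continuous_re.tendsto _).comp h
  simpa using h2

/-- **The endpoint step.** If `m N δ → e δ` for every `δ ∈ [0,1)`, the family `m N` is
equi-Lipschitz at `1` (`|m N 1 - m N δ| ≤ L (1 - δ)` on `[0,1]`) and `e` is continuous at `1`
within `[0,1]`, then `m N 1 → e 1`. -/
theorem tendsto_endpoint {m : ℕ → ℝ → ℝ} {e : ℝ → ℝ} {L : ℝ}
    (hconv : ∀ δ ∈ Ico (0 : ℝ) 1, Tendsto (fun N => m N δ) atTop (𝓝 (e δ)))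
    (he : ContinuousWithinAt e (Icc (0 : ℝ) 1) 1)
    (hlip : ∀ N, ∀ δ ∈ Icc (0 : ℝ) 1, |m N 1 - m N δ| ≤ L * (1 - δ)) :
    Tendsto (fun N => m N 1) atTop (𝓝 (e 1)) := by
  rw [Metric.tendsto_atTop]
  intro ε hε
  -- continuity of `e` at `1` within `[0,1]`
  obtain ⟨η, hη, hηe⟩ : ∃ η > 0, ∀ x ∈ Icc (0 : ℝ) 1, dist x 1 < η → dist (e x) (e 1) < ε / 3 :=
    Metric.continuousWithinAt_iff.1 he (ε / 3) (by positivity)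
  -- choose `δ < 1` close to `1`
  set s : ℝ := min (min η (ε / (3 * (|L| + 1)))) 1 / 2 with hs
  have hL1 : 0 < |L| + 1 := by positivity
  have hs0 : 0 < s := by positivity
  have hs1 : s ≤ 1 / 2 := by
    have : min (min η (ε / (3 * (|L| + 1)))) 1 ≤ 1 := min_le_right _ _
    rw [hs]; linarith
  have hsη : s < η := by
    have : min (min η (ε / (3 * (|L| + 1)))) 1 ≤ η := (min_le_left _ _).trans (min_le_left _ _)
    rw [hs]; linarith
  have hsε : s < ε / (3 * (|L| + 1)) := by
    have : min (min η (ε / (3 * (|L| + 1)))) 1 ≤ ε / (3 * (|L| + 1)) :=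
      (min_le_left _ _).trans (min_le_right _ _)
    have hpos : 0 < ε / (3 * (|L| + 1)) := by positivity
    rw [hs]; linarith
  set δ : ℝ := 1 - s with hδ
  have hδ0 : δ ∈ Ico (0 : ℝ) 1 := ⟨by rw [hδ]; linarith, by rw [hδ]; linarith⟩
  have hδI : δ ∈ Icc (0 : ℝ) 1 := ⟨hδ0.1, hδ0.2.le⟩
  -- the three errors
  have h3 : dist (e δ) (e 1) < ε / 3 := hηe δ hδI (by
    rw [Real.dist_eq, hδ, show 1 - s - 1 = -s by ring, abs_neg, abs_of_pos hs0]; exact hsη)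
  have h1 : ∀ N, |m N 1 - m N δ| < ε / 3 := fun N => by
    calc |m N 1 - m N δ| ≤ L * (1 - δ) := hlip N δ hδI
      _ ≤ |L| * (1 - δ) := mul_le_mul_of_nonneg_right (le_abs_self L) (by linarith [hδ0.2])
      _ = |L| * s := by rw [hδ]; ring
      _ ≤ (|L| + 1) * s := mul_le_mul_of_nonneg_right (by linarith) hs0.le
      _ < (|L| + 1) * (ε / (3 * (|L| + 1))) := mul_lt_mul_of_pos_left hsε hL1
      _ = ε / 3 := by field_simp
  obtain ⟨N₀, hN₀⟩ := (Metric.tendsto_atTop.1 (hconv δ hδ0)) (ε / 3) (by positivity)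
  refine ⟨N₀, fun N hN => ?_⟩
  have h2 := hN₀ N hN
  rw [Real.dist_eq] at h2 h3 ⊢
  calc |m N 1 - e 1| = |(m N 1 - m N δ) + (m N δ - e δ) + (e δ - e 1)| := by congr 1; ring
    _ ≤ |m N 1 - m N δ| + |m N δ - e δ| + |e δ - e 1| := abs_add_three _ _ _
    _ < ε / 3 + ε / 3 + ε / 3 := by gcongr; exact h1 N
    _ = ε := by ring

end Summit.AtomisticToContinuum.HydrodynamicLimit.Theorems.AmplitudeTransfer
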